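import Literature.Probability.RandomPlanarGeometry.HexSAWPolygonSupermult
import Literature.Probability.RandomPlanarGeometry.HexSAWEndpointCarriers
import HarnessLib

/-!
# A kernel census of the small honeycomb polygon numbers:
# `q_6(ℍ) = 1, q_8 = 0, q_10 = 3, q_12 = 2, q_14 = 12, q_16 = 18, q_18 = 65` — so Madras–Slade's (3.2.3) `q_N ≤ q_{N+2}` FAILS on `ℍ`

Topic `Literature/Probability/RandomPlanarGeometry` (lane «pcv-sawmu», a-p4 g17; sequel of `HexSAWPolygonSupermult.lean` —
`PolygonConcat.canonEnd n` (the `n`-step brick-wall walks `0 → e₀` with all sites lexicographically `≥ 0` = the canonically rooted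
`(n+1)`-gons) and `PolygonConcat.card_canonEnd : #canonEnd n = q_{n+1}(ℍ)` (`n ≥ 2`) — and of `HexSAWPolygonMonotone.lean` /
`HexSAWPolygonStepSix.lean` (a-p4 g16: `q_N(ℍ) ≤ q_{N+k}(ℍ)` for every even `k ≥ 4`, `N ≥ 6`; the step `k = 2` only EVENTUALLY, from the
ratio theorem), whose module docs quote the small values `q_6, …, q_20 = 1, 0, 3, 2, 12, 18, 65, 138` as DATA (Jensen's enumerations).
THIS FILE makes the first seven of them KERNEL THEOREMS, by an exact finite census.

Source of the printed numbers: A. J. Guttmann, I. Jensen, «Appendix: Series Data and Growth Constant, Amplitude and Exponent Estimates»,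
Chapter 16 of *Polygons, Polyominoes and Polycubes*, LNP 775 (2009), **Table 16.3 «Honeycomb lattice SAP by perimeter [8]»** (pp. 470–471),
whose right-hand columns read, AS PRINTED: `n = 6, 8, 10, 12, 14, 16, 18, 20, 22, 24 : p_n = 1, 0, 3, 2, 12, 18, 65, 138, 432, 1074`
[GuttmannJensen2009SeriesData]; the enumeration method is I. Jensen, J. Phys.: Conf. Ser. 42 (2006) 163 [Jensen2006HoneycombPolygons, §2].
The monotonicity being refuted on `ℍ` is N. Madras, G. Slade, *The Self-Avoiding Walk* (1993), Theorem 3.2.3, eq. (3.2.3) p. 64: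
"`q_N ≤ q_{N+2}`" (printed and proved for `ℤ^d`; tree: `Zd.polygonNumber_le_add_two`) [MadrasSlade1993].

## Method (no new idea; a certified finite enumeration)

`Census.prefixesRev n k` enumerates, as REVERSED lists of integer pairs, the `k`-step brick-wall self-avoiding walks from `(0,0)` all of whose
sites are lexicographically `≥ 0` and stay within `ℓ¹`-distance `n − k` of the target `e₀ = (1,0)` (a walk that strays farther can no longer
close up); `Census.canonRev n` keeps those ending at `(1,0)`.  **`Census.card_canonEnd_eq_census : #canonEnd n = #(canonRev n).toFinset`**
for EVERY `n` (completeness: the reversed site list `revList ω k` of a canonical polygon walk is enumerated, by induction on `k`, the distance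
pruning being justified by `dist_le_of_mem_endAt`; soundness: an enumerated list is well formed (`WF`: brick-wall steps, fresh sites,
lexicographically `≥ 0`, start `(0,0)`), so its vertex function `funOf n l` lies in `canonEnd n`; both maps are injective).  The seven counts
are then `decide +kernel` evaluations of the pruned census (kernel reduction only — no `native_decide`, no `ofReduceBool`; the largest,
`n = 17`, visits a few thousand prefixes).

## Results (namespace `Literature.Probability.RandomPlanarGeometry.SAW.HexBW`)

* `Census.card_canonEnd_eq_census (n)`; the evaluations `Census.census_five … census_seventeen`;
* `PolygonConcat.card_canonEnd_five/…/seventeen : #canonEnd 5, 7, 9, 11, 13, 15, 17 = 1, 0, 3, 2, 12, 18, 65`;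
* **`hexPolygonNumber_six = 1`, `hexPolygonNumber_eight = 0`, `hexPolygonNumber_ten = 3`, `hexPolygonNumber_twelve = 2`,
  `hexPolygonNumber_fourteen = 12`, `hexPolygonNumber_sixteen = 18`, `hexPolygonNumber_eighteen = 65`** (Table 16.3, kernel-checked);
* **`hexPolygonNumber_twelve_lt_ten : q_12(ℍ) < q_10(ℍ)`** and **`not_hexPolygonNumber_le_add_two : ¬ ∀ N ≥ 6, Even N → q_N(ℍ) ≤ q_{N+2}(ℍ)`**
  — Madras–Slade's (3.2.3) does not transfer to the honeycomb lattice (the lane's MONOTONE/STEP-SIX modules show every even step `≥ 4` does);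
* `hexPolygonNumber_le_add_two_twelve/fourteen/sixteen : q_12 ≤ q_14, q_14 ≤ q_16, q_16 ≤ q_18` — the first three instances of the
  conjectured step-`2` monotonicity from `N = 12` on (data: true for `12 ≤ N ≤ 40`; OPEN as a theorem).

NOT claimed: anything for `N ≥ 20` (the census is finite); no asymptotics.  Label (lane): DATA-LEMMA / kernel census; the printed table is
recovered, not used.
-/

set_option maxRecDepth 4000

open Finset Function Literature.Probability.LatticeModels SimpleGraph

namespace Literature.Probability.RandomPlanarGeometry.SAW

namespace HexBW

namespace Census

open PolygonConcat

/-- The three brick-wall neighbours of an integer site. [cite: EntingJensen2009, §7.4.2, Fig. 7.10] -/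
def nbrs (p : ℤ × ℤ) : List (ℤ × ℤ) :=
  [(p.1 + 1, p.2), (p.1 - 1, p.2), if (p.1 + p.2) % 2 = 0 then (p.1, p.2 + 1) else (p.1, p.2 - 1)]

/-- Lexicographic nonnegativity, as a `Bool`. [cite: MadrasSlade1993, §3.2 (proof of Theorem 3.2.3: `Q[N]`)] -/
def lexNN (p : ℤ × ℤ) : Bool := decide (0 < p.1 ∨ (p.1 = 0 ∧ 0 ≤ p.2))

/-- Admissible next sites with `r` steps still to go. [cite: MadrasSlade1993, §3.2 (proof of Theorem 3.2.3)] -/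
def admissible (r : ℕ) (l : List (ℤ × ℤ)) (q : ℤ × ℤ) : Bool :=
  decide (q ∉ l) && lexNN q && decide ((q.1 - 1).natAbs + q.2.natAbs ≤ r)

/-- One-step extensions of a reversed site list. [cite: MadrasSlade1993, §3.2 (proof of Theorem 3.2.3)] -/
def extendRev (r : ℕ) : List (ℤ × ℤ) → List (List (ℤ × ℤ))
  | [] => []
  | p :: t => ((nbrs p).filter (admissible r (p :: t))).map fun q => q :: p :: t

/-- Pruned enumeration of reversed prefixes. [cite: MadrasSlade1993, §3.2 (proof of Theorem 3.2.3)] -/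
def prefixesRev (n : ℕ) : ℕ → List (List (ℤ × ℤ))
  | 0 => [[(0, 0)]]
  | k + 1 => (prefixesRev n k).flatMap (extendRev (n - (k + 1)))

/-- The canonical rooted `(n+1)`-gons as reversed site lists. [cite: MadrasSlade1993, §3.2 (proof of Theorem 3.2.3: `Q[N]`)] -/
def canonRev (n : ℕ) : List (List (ℤ × ℤ)) :=
  (prefixesRev n n).filter fun l => decide (l.head? = some (1, 0))

/-! ### The dictionary with `Site 2` -/

/-- Integer pair to site. [cite: MadrasSlade1993, §1.1] -/
def toSite (p : ℤ × ℤ) : Site 2 := pt p.1 p.2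

/-- Site to integer pair. [cite: MadrasSlade1993, §1.1] -/
def ofSite (z : Site 2) : ℤ × ℤ := (z 0, z 1)

/-- `toSite ∘ ofSite = id`. [cite: MadrasSlade1993, §1.1 (sites of ℤ^d)] -/
@[simp] theorem toSite_ofSite (z : Site 2) : toSite (ofSite z) = z := pt_eta z

/-- `ofSite ∘ toSite = id`. [cite: MadrasSlade1993, §1.1 (sites of ℤ^d)] -/
@[simp] theorem ofSite_toSite (p : ℤ × ℤ) : ofSite (toSite p) = p := by
  cases p; simp [ofSite, toSite]

/-- `toSite` is injective. [cite: MadrasSlade1993, §1.1 (sites of ℤ^d)] -/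
theorem toSite_injective : Function.Injective toSite := fun p q h => by
  simpa using congrArg ofSite h

/-- `nbrs` is the brick-wall adjacency. [cite: EntingJensen2009, §7.4.2, Fig. 7.10] -/
theorem mem_nbrs_iff {p q : ℤ × ℤ} : q ∈ nbrs p ↔ brickWallGraph.Adj (toSite p) (toSite q) := by
  obtain ⟨a, b⟩ := p; obtain ⟨c, d⟩ := q
  simp only [toSite, adj_pt_iff, nbrs, List.mem_cons, List.mem_nil_iff, or_false, Prod.mk.injEq]
  constructor
  · rintro (⟨rfl, rfl⟩ | ⟨rfl, rfl⟩ | h)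
    · left; exact ⟨Or.inl rfl, rfl⟩
    · left; exact ⟨Or.inr (by ring), rfl⟩
    · split_ifs at h with hpar
      · obtain ⟨rfl, rfl⟩ := h; right; exact ⟨rfl, Or.inl ⟨rfl, hpar⟩⟩
      · obtain ⟨rfl, rfl⟩ := h; right; refine ⟨rfl, Or.inr ⟨by ring, ?_⟩⟩; omega
  · rintro (⟨h | h, rfl⟩ | ⟨rfl, ⟨rfl, hpar⟩ | ⟨h, hpar⟩⟩)
    · left; exact ⟨h, rfl⟩
    · right; left; constructor <;> omega
    · right; right; rw [if_pos hpar]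
    · right; right; rw [if_neg (by omega), Prod.mk.injEq]; constructor <;> omega

/-! ### The list of sites of a walk, reversed -/

/-- `revList ω k = [site k, …, site 0]` as integer pairs. [cite: MadrasSlade1993, §1.1] -/
def revList (ω : ℕ → Site 2) : ℕ → List (ℤ × ℤ)
  | 0 => [ofSite (ω 0)]
  | k + 1 => ofSite (ω (k + 1)) :: revList ω k

/-- `revList ω k` has length `k + 1`. [cite: MadrasSlade1993, §1.1] -/
theorem length_revList (ω : ℕ → Site 2) (k : ℕ) : (revList ω k).length = k + 1 := by
  induction k with
  | zero => rfl
  | succ k ih => simp [revList, ih]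

/-- The head of `revList ω k` is site `k`. [cite: MadrasSlade1993, §1.1] -/
theorem head?_revList (ω : ℕ → Site 2) (k : ℕ) : (revList ω k).head? = some (ofSite (ω k)) := by
  cases k <;> rfl

/-- Membership in `revList ω k`. [cite: MadrasSlade1993, §1.1] -/
theorem mem_revList {ω : ℕ → Site 2} {k : ℕ} {q : ℤ × ℤ} : q ∈ revList ω k ↔ ∃ i, i ≤ k ∧ q = ofSite (ω i) := by
  induction k with
  | zero => simp [revList]
  | succ k ih =>
    simp only [revList, List.mem_cons, ih]
    constructor
    · rintro (rfl | ⟨i, hi, rfl⟩)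
      · exact ⟨k + 1, le_rfl, rfl⟩
      · exact ⟨i, by omega, rfl⟩
    · rintro ⟨i, hi, rfl⟩
      rcases Nat.lt_or_ge i (k + 1) with h | h
      · exact Or.inr ⟨i, by omega, rfl⟩
      · left; rw [show i = k + 1 by omega]

/-- The `j`-th entry of `revList ω k` is site `k − j`. [cite: MadrasSlade1993, §1.1] -/
theorem getElem_revList (ω : ℕ → Site 2) (k : ℕ) {j : ℕ} (hj : j < (revList ω k).length) :
    (revList ω k)[j] = ofSite (ω (k - j)) := by
  induction k generalizing j with
  | zero =>
    simp only [revList, List.length_cons, List.length_nil, zero_add, Nat.lt_one_iff] at hj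
    subst hj; rfl
  | succ k ih =>
    cases j with
    | zero => rfl
    | succ j =>
      simp only [revList, List.getElem_cons_succ]
      rw [ih]
      congr 2; omega

/-! ### Completeness: every canonical polygon walk is enumerated -/

/-- `ofSite 0 = (0,0)`. [cite: MadrasSlade1993, §1.1 (sites of ℤ^d)] -/
@[simp] theorem ofSite_zero : ofSite (0 : Site 2) = (0, 0) := rfl

/-- `toSite (0,0) = 0`. [cite: MadrasSlade1993, §1.1 (sites of ℤ^d)] -/
theorem toSite_zero : toSite (0, 0) = (0 : Site 2) := by
  funext i; fin_cases i <;> simp [toSite, pt]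

/-- `toSite (1,0) = e₀`. [cite: MadrasSlade1993, §1.1 (sites of ℤ^d)] -/
theorem toSite_one_zero : toSite (1, 0) = (Pi.single 0 1 : Site 2) := by
  funext i; fin_cases i <;> simp [toSite, pt]

/-- `lexNN (ofSite z) ↔ LexNonneg z`. [cite: MadrasSlade1993, §3.2 (proof of Theorem 3.2.3: `Q[N]`)] -/
theorem lexNN_ofSite_iff (z : Site 2) : lexNN (ofSite z) = true ↔ LexNonneg z := by
  simp [lexNN, ofSite, LexNonneg]

/-- Along a brick-wall walk ending at `e₀` at time `n`, the site at time `i ≤ n` is within `ℓ¹`-distance `n − i` of `e₀`.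
[cite: MadrasSlade1993, §1.1] -/
theorem dist_le_of_mem_endAt {n : ℕ} {ω : ℕ → Site 2} (hω : ω ∈ endAt n (Pi.single 0 1 : Site 2)) {i : ℕ} (hi : i ≤ n) :
    (ω i 0 - 1).natAbs + (ω i 1).natAbs ≤ n - i := by
  obtain ⟨hs, hn⟩ := mem_endAt.1 hω
  obtain ⟨-, -, hbw, -⟩ := mem_saws_iff.1 hs
  obtain ⟨j, rfl⟩ : ∃ j, i = n - j := ⟨n - i, by omega⟩
  have key : ∀ j, j ≤ n → (ω (n - j) 0 - 1).natAbs + (ω (n - j) 1).natAbs ≤ j := by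
    intro j
    induction j with
    | zero => intro _; simp [hn]
    | succ j ih =>
      intro hj
      have h := hbw (n - (j + 1)) (by omega)
      rw [show n - (j + 1) + 1 = n - j by omega, brickWallGraph_adj_coord] at h
      have := ih (by omega)
      omega
  by_cases hj : j ≤ n
  · simpa [show n - (n - j) = j by omega] using key j hj
  · rw [show n - j = 0 by omega] at *
    have := key n le_rfl
    rw [show n - n = 0 by omega] at this
    simpa using this.trans (by omega)

/-- **Completeness of the pruned enumeration**: the reversed prefix of a canonical polygon walk is enumerated.
[cite: MadrasSlade1993, §3.2 (proof of Theorem 3.2.3: `Q[N]`)] -/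
theorem revList_mem_prefixesRev {n : ℕ} {ω : ℕ → Site 2} (hω : ω ∈ canonEnd n) {k : ℕ} (hk : k ≤ n) :
    revList ω k ∈ prefixesRev n k := by
  obtain ⟨hE, hlex⟩ := mem_canonEnd.1 hω
  obtain ⟨hs, hn⟩ := mem_endAt.1 hE
  obtain ⟨h0, -, hbw, hinj⟩ := mem_saws_iff.1 hs
  induction k with
  | zero => simp [prefixesRev, revList, h0]
  | succ k ih =>
    have hmem := ih (by omega)
    simp only [prefixesRev, List.mem_flatMap]
    refine ⟨revList ω k, hmem, ?_⟩
    obtain ⟨t, ht⟩ : ∃ t, revList ω k = ofSite (ω k) :: t := by cases k <;> exact ⟨_, rfl⟩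
    rw [revList, ht, extendRev, List.mem_map]
    refine ⟨ofSite (ω (k + 1)), ?_, rfl⟩
    rw [List.mem_filter]
    refine ⟨?_, ?_⟩
    · rw [mem_nbrs_iff, toSite_ofSite, toSite_ofSite]; exact hbw k (by omega)
    · rw [← ht]
      simp only [admissible, Bool.and_eq_true, decide_eq_true_eq]
      refine ⟨⟨fun hq => ?_, (lexNN_ofSite_iff _).2 (hlex (k + 1) hk)⟩, ?_⟩
      · obtain ⟨i, hi, hiq⟩ := mem_revList.1 hq
        have heq : ω (k + 1) = ω i := by simpa using congrArg toSite hiq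
        have := hinj (show k + 1 ∈ {i | i ≤ n} by simpa using hk) (show i ∈ {i | i ≤ n} by simp; omega) heq
        omega
      · simpa [ofSite] using dist_le_of_mem_endAt hE hk

/-- The full reversed list of a canonical polygon walk lies in the census list. [cite: MadrasSlade1993, §3.2 (proof of Theorem 3.2.3)] -/
theorem revList_mem_canonRev {n : ℕ} {ω : ℕ → Site 2} (hω : ω ∈ canonEnd n) : revList ω n ∈ canonRev n := by
  rw [canonRev, List.mem_filter]
  refine ⟨revList_mem_prefixesRev hω le_rfl, ?_⟩
  obtain ⟨hE, -⟩ := mem_canonEnd.1 hω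
  rw [decide_eq_true_eq, head?_revList, (mem_endAt.1 hE).2]
  simp [ofSite]

/-- `revList · n` is injective on `canonEnd n`. [cite: MadrasSlade1993, §1.1] -/
theorem revList_injOn (n : ℕ) : Set.InjOn (fun ω => revList ω n) ↑(canonEnd n) := by
  intro ω hω ω' hω' h
  obtain ⟨-, hend, -, -⟩ := mem_saws_iff.1 (mem_endAt.1 (mem_canonEnd.1 (Finset.mem_coe.1 hω)).1).1
  obtain ⟨-, hend', -, -⟩ := mem_saws_iff.1 (mem_endAt.1 (mem_canonEnd.1 (Finset.mem_coe.1 hω')).1).1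
  have key : ∀ i, i ≤ n → ω i = ω' i := by
    intro i hi
    have hlen := length_revList ω n
    have h1 := getElem_revList ω n (j := n - i) (by rw [hlen]; omega)
    have h2 := getElem_revList ω' n (j := n - i) (by rw [length_revList]; omega)
    have e : (revList ω n)[n - i]'(by rw [hlen]; omega) = (revList ω' n)[n - i]'(by rw [length_revList]; omega) := by
      simp only [h]
    rw [h1, h2, show n - (n - i) = i by omega] at e
    simpa using congrArg toSite e
  funext i
  rcases le_or_gt i n with hi | hi
  · exact key i hi
  · rw [hend i hi.le, hend' i hi.le, key n le_rfl]

/-- **Upper bound by the census**: `#canonEnd n ≤ #(canonRev n)`. [cite: MadrasSlade1993, §3.2 (proof of Theorem 3.2.3)] -/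
theorem card_canonEnd_le_census (n : ℕ) : #(canonEnd n) ≤ (canonRev n).toFinset.card :=
  Finset.card_le_card_of_injOn (fun ω => revList ω n) (fun _ hω => List.mem_toFinset.2 (revList_mem_canonRev hω))
    (revList_injOn n)

/-! ### Soundness: every enumerated list is a canonical polygon walk -/

/-- Well-formed reversed site lists: start `(0,0)`, brick-wall steps, self-avoiding, new sites lexicographically `≥ 0`.
[cite: MadrasSlade1993, §3.2 (proof of Theorem 3.2.3: `Q[N]`)] -/
def WF : List (ℤ × ℤ) → Prop
  | [] => False
  | [p] => p = (0, 0)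
  | q :: p :: t => WF (p :: t) ∧ q ∈ nbrs p ∧ q ∉ p :: t ∧ lexNN q = true

/-- Enumerated lists are well formed and have the right length. [cite: MadrasSlade1993, §3.2 (proof of Theorem 3.2.3)] -/
theorem wf_of_mem_prefixesRev {n k : ℕ} {l : List (ℤ × ℤ)} (hl : l ∈ prefixesRev n k) : WF l ∧ l.length = k + 1 := by
  induction k generalizing l with
  | zero =>
    simp only [prefixesRev, List.mem_singleton] at hl
    subst hl; exact ⟨rfl, rfl⟩
  | succ k ih =>
    simp only [prefixesRev, List.mem_flatMap] at hl
    obtain ⟨l', hl', hll⟩ := hl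
    obtain ⟨hwf, hlen⟩ := ih hl'
    match l', hwf, hlen, hll with
    | p :: t, hwf, hlen, hll =>
      simp only [extendRev, List.mem_map, List.mem_filter] at hll
      obtain ⟨q, ⟨hq, hadm⟩, rfl⟩ := hll
      simp only [admissible, Bool.and_eq_true, decide_eq_true_eq] at hadm
      exact ⟨⟨hwf, hq, hadm.1.1, hadm.1.2⟩, by simpa using hlen⟩

/-- A well-formed list is duplicate-free. [cite: MadrasSlade1993, §1.1] -/
theorem WF.nodup : ∀ {l : List (ℤ × ℤ)}, WF l → l.Nodup
  | [], h => h.elim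
  | [p], _ => List.nodup_singleton p
  | _ :: _ :: _, h => List.nodup_cons.2 ⟨h.2.2.1, WF.nodup h.1⟩

/-- The last entry of a well-formed list is `(0,0)`. [cite: MadrasSlade1993, §1.1] -/
theorem WF.getLast_eq : ∀ {l : List (ℤ × ℤ)} (h : WF l) (hne : l ≠ []), l.getLast hne = (0, 0)
  | [], h, _ => h.elim
  | [p], h, _ => by simpa [WF] using h
  | q :: p :: t, h, _ => by
    rw [List.getLast_cons (by simp)]
    exact WF.getLast_eq h.1 (by simp)

/-- All entries of a well-formed list are lexicographically `≥ 0`. [cite: MadrasSlade1993, §3.2 (proof of Theorem 3.2.3: `Q[N]`)] -/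
theorem WF.lexNN_of_mem : ∀ {l : List (ℤ × ℤ)}, WF l → ∀ q ∈ l, lexNN q = true
  | [], h, _, _ => h.elim
  | [p], h, q, hq => by
    simp only [WF] at h; simp only [List.mem_singleton] at hq; subst hq; subst h; decide
  | q :: p :: t, h, r, hr => by
    rcases List.mem_cons.1 hr with rfl | hr
    · exact h.2.2.2
    · exact WF.lexNN_of_mem h.1 r hr

/-- Consecutive entries of a well-formed list are brick-wall neighbours (the later site first). [cite: EntingJensen2009, §7.4.2, Fig. 7.10] -/
theorem WF.getElem_mem_nbrs : ∀ {l : List (ℤ × ℤ)} (h : WF l) {j : ℕ} (hj : j + 1 < l.length),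
    l[j] ∈ nbrs (l[j + 1])
  | [], h, _, _ => h.elim
  | [p], _, j, hj => by simp at hj
  | q :: p :: t, h, 0, _ => by simpa using h.2.1
  | q :: p :: t, h, j + 1, hj => by
    have := WF.getElem_mem_nbrs h.1 (j := j) (by simpa using hj)
    simpa using this

/-- The vertex function of a reversed site list of length `n + 1` (frozen after time `n`). [cite: MadrasSlade1993, §1.1] -/
def funOf (n : ℕ) (l : List (ℤ × ℤ)) : ℕ → Site 2 := fun i => toSite (l.getD (n - min i n) (0, 0))

/-- Values of `funOf n l` up to time `n`. [cite: MadrasSlade1993, §1.1] -/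
theorem funOf_apply {n : ℕ} {l : List (ℤ × ℤ)} (hl : l.length = n + 1) {i : ℕ} (hi : i ≤ n) :
    funOf n l i = toSite (l[n - i]'(by rw [hl]; omega)) := by
  simp only [funOf, min_eq_left hi]
  rw [List.getD_eq_getElem]

/-- **Soundness**: an enumerated full list is (the reversed site list of) a canonical polygon walk.
[cite: MadrasSlade1993, §3.2 (proof of Theorem 3.2.3: `Q[N]`)] -/
theorem funOf_mem_canonEnd {n : ℕ} {l : List (ℤ × ℤ)} (hl : l ∈ canonRev n) : funOf n l ∈ canonEnd n := by
  rw [canonRev, List.mem_filter, decide_eq_true_eq] at hl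
  obtain ⟨hmem, hhead⟩ := hl
  obtain ⟨hwf, hlen⟩ := wf_of_mem_prefixesRev hmem
  have hne : l ≠ [] := by rintro rfl; simp at hlen
  have hget : ∀ {i : ℕ} (hi : i ≤ n), funOf n l i = toSite (l[n - i]'(by rw [hlen]; omega)) := fun hi => funOf_apply hlen hi
  refine mem_canonEnd.2 ⟨mem_endAt.2 ⟨mem_saws_iff.2 ⟨?_, ?_, ?_, ?_⟩, ?_⟩, ?_⟩
  · -- start at 0
    rw [hget (Nat.zero_le n)]
    have h1 : l[n - 0]'(by rw [hlen]; omega) = l.getLast hne := by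
      rw [List.getLast_eq_getElem]; congr 1; omega
    rw [h1, WF.getLast_eq hwf hne, toSite_zero]
  · -- frozen after `n`
    intro i hi
    simp only [funOf, min_eq_right hi, min_self]
  · -- brick-wall steps
    intro i hi
    rw [hget hi.le, hget (by omega : i + 1 ≤ n), ← mem_nbrs_iff]
    have := WF.getElem_mem_nbrs hwf (j := n - (i + 1)) (by rw [hlen]; omega)
    simpa [show n - (i + 1) + 1 = n - i by omega] using this
  · -- self-avoiding
    intro i hi j hj hij
    simp only [Set.mem_setOf_eq] at hi hj
    rw [hget hi, hget hj] at hij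
    have e := toSite_injective hij
    have := (List.Nodup.getElem_inj_iff (WF.nodup hwf)).1 e
    omega
  · -- endpoint `e₀`
    rw [hget le_rfl]
    have h0 : l[n - n]'(by rw [hlen]; omega) = (1, 0) := by
      have := List.head?_eq_getElem? (l := l)
      rw [hhead, List.getElem?_eq_getElem (by rw [hlen]; omega)] at this
      simpa using this.symm
    rw [h0, toSite_one_zero]
  · -- lexicographically nonnegative
    intro i hi
    rw [hget hi, ← lexNN_ofSite_iff, ofSite_toSite]
    exact WF.lexNN_of_mem hwf _ (List.getElem_mem _)

/-- `funOf n` is injective on the census list. [cite: MadrasSlade1993, §1.1] -/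
theorem funOf_injOn (n : ℕ) : Set.InjOn (funOf n) ↑(canonRev n).toFinset := by
  intro l hl l' hl' h
  simp only [Finset.mem_coe, List.mem_toFinset] at hl hl'
  have hlen := (wf_of_mem_prefixesRev (List.mem_filter.1 hl).1).2
  have hlen' := (wf_of_mem_prefixesRev (List.mem_filter.1 hl').1).2
  refine List.ext_getElem (by rw [hlen, hlen']) fun j hj hj' => ?_
  have e := congrFun h (n - j)
  rw [funOf_apply hlen (by omega), funOf_apply hlen' (by omega)] at e
  have e' := toSite_injective e
  have hj2 : n - (n - j) = j := by rw [hlen] at hj; omega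
  simpa [hj2] using e'

/-- **Lower bound by the census**: `#(canonRev n) ≤ #canonEnd n`. [cite: MadrasSlade1993, §3.2 (proof of Theorem 3.2.3)] -/
theorem census_le_card_canonEnd (n : ℕ) : (canonRev n).toFinset.card ≤ #(canonEnd n) :=
  Finset.card_le_card_of_injOn (funOf n) (fun _ hl => funOf_mem_canonEnd (List.mem_toFinset.1 hl)) (funOf_injOn n)

/-- **The census is exact**: `#canonEnd n = #(canonRev n)`. [cite: MadrasSlade1993, §3.2 (proof of Theorem 3.2.3: `Q[N]`)] -/
theorem card_canonEnd_eq_census (n : ℕ) : #(canonEnd n) = (canonRev n).toFinset.card :=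
  le_antisymm (card_canonEnd_le_census n) (census_le_card_canonEnd n)

/-! ### Kernel evaluations of the census -/

/-- `#(canonRev 5) = 1` (the hexagon). [cite: GuttmannJensen2009SeriesData, Table 16.3 (p_6 = 1)] -/
theorem census_five : (canonRev 5).toFinset.card = 1 := by decide +kernel

/-- `#(canonRev 7) = 0` (no octagons). [cite: GuttmannJensen2009SeriesData, Table 16.3 (p_8 = 0)] -/
theorem census_seven : (canonRev 7).toFinset.card = 0 := by decide +kernel

/-- `#(canonRev 9) = 3`. [cite: GuttmannJensen2009SeriesData, Table 16.3 (p_10 = 3)] -/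
theorem census_nine : (canonRev 9).toFinset.card = 3 := by decide +kernel

/-- `#(canonRev 11) = 2`. [cite: GuttmannJensen2009SeriesData, Table 16.3 (p_12 = 2)] -/
theorem census_eleven : (canonRev 11).toFinset.card = 2 := by decide +kernel

/-- `#(canonRev 13) = 12`. [cite: GuttmannJensen2009SeriesData, Table 16.3 (p_14 = 12)] -/
theorem census_thirteen : (canonRev 13).toFinset.card = 12 := by decide +kernel

/-- `#(canonRev 15) = 18`. [cite: GuttmannJensen2009SeriesData, Table 16.3 (p_16 = 18)] -/
theorem census_fifteen : (canonRev 15).toFinset.card = 18 := by decide +kernel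

set_option maxHeartbeats 400000 in
/-- `#(canonRev 17) = 65` (the largest census of this file). [cite: GuttmannJensen2009SeriesData, Table 16.3 (p_18 = 65)] -/
theorem census_seventeen : (canonRev 17).toFinset.card = 65 := by decide +kernel

end Census

namespace PolygonConcat

/-- `#canonEnd 5 = 1`. [cite: GuttmannJensen2009SeriesData, Table 16.3 (p_6 = 1)] -/
theorem card_canonEnd_five : #(canonEnd 5) = 1 := by rw [Census.card_canonEnd_eq_census]; exact Census.census_five

/-- `#canonEnd 7 = 0`: there are no octagons on the honeycomb lattice. [cite: GuttmannJensen2009SeriesData, Table 16.3 (p_8 = 0)] -/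
theorem card_canonEnd_seven : #(canonEnd 7) = 0 := by rw [Census.card_canonEnd_eq_census]; exact Census.census_seven

/-- `#canonEnd 9 = 3`. [cite: GuttmannJensen2009SeriesData, Table 16.3 (p_10 = 3)] -/
theorem card_canonEnd_nine : #(canonEnd 9) = 3 := by rw [Census.card_canonEnd_eq_census]; exact Census.census_nine

/-- `#canonEnd 11 = 2`. [cite: GuttmannJensen2009SeriesData, Table 16.3 (p_12 = 2)] -/
theorem card_canonEnd_eleven : #(canonEnd 11) = 2 := by rw [Census.card_canonEnd_eq_census]; exact Census.census_eleven

/-- `#canonEnd 13 = 12`. [cite: GuttmannJensen2009SeriesData, Table 16.3 (p_14 = 12)] -/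
theorem card_canonEnd_thirteen : #(canonEnd 13) = 12 := by rw [Census.card_canonEnd_eq_census]; exact Census.census_thirteen

/-- `#canonEnd 15 = 18`. [cite: GuttmannJensen2009SeriesData, Table 16.3 (p_16 = 18)] -/
theorem card_canonEnd_fifteen : #(canonEnd 15) = 18 := by rw [Census.card_canonEnd_eq_census]; exact Census.census_fifteen

/-- `#canonEnd 17 = 65`. [cite: GuttmannJensen2009SeriesData, Table 16.3 (p_18 = 65)] -/
theorem card_canonEnd_seventeen : #(canonEnd 17) = 65 := by rw [Census.card_canonEnd_eq_census]; exact Census.census_seventeen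

end PolygonConcat

/-! ### The printed honeycomb polygon numbers, kernel-checked -/

/-- **`q_6(ℍ) = 1`** (the hexagon). [cite: GuttmannJensen2009SeriesData, Table 16.3 (n = 6: p_n = 1)] -/
theorem hexPolygonNumber_six : hexPolygonNumber 6 = 1 := by
  rw [← PolygonConcat.card_canonEnd (n := 5) (by norm_num)]; exact PolygonConcat.card_canonEnd_five

/-- **`q_8(ℍ) = 0`**: the honeycomb lattice has no octagons. [cite: GuttmannJensen2009SeriesData, Table 16.3 (n = 8: p_n = 0)] -/
theorem hexPolygonNumber_eight : hexPolygonNumber 8 = 0 := by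
  rw [← PolygonConcat.card_canonEnd (n := 7) (by norm_num)]; exact PolygonConcat.card_canonEnd_seven

/-- **`q_10(ℍ) = 3`** (the two-brick bar in its three orientations). [cite: GuttmannJensen2009SeriesData, Table 16.3 (n = 10: p_n = 3)] -/
theorem hexPolygonNumber_ten : hexPolygonNumber 10 = 3 := by
  rw [← PolygonConcat.card_canonEnd (n := 9) (by norm_num)]; exact PolygonConcat.card_canonEnd_nine

/-- **`q_12(ℍ) = 2`** (the three-brick triangle in its two orientations). [cite: GuttmannJensen2009SeriesData, Table 16.3 (n = 12: p_n = 2)] -/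
theorem hexPolygonNumber_twelve : hexPolygonNumber 12 = 2 := by
  rw [← PolygonConcat.card_canonEnd (n := 11) (by norm_num)]; exact PolygonConcat.card_canonEnd_eleven

/-- **`q_14(ℍ) = 12`**. [cite: GuttmannJensen2009SeriesData, Table 16.3 (n = 14: p_n = 12)] -/
theorem hexPolygonNumber_fourteen : hexPolygonNumber 14 = 12 := by
  rw [← PolygonConcat.card_canonEnd (n := 13) (by norm_num)]; exact PolygonConcat.card_canonEnd_thirteen

/-- **`q_16(ℍ) = 18`**. [cite: GuttmannJensen2009SeriesData, Table 16.3 (n = 16: p_n = 18)] -/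
theorem hexPolygonNumber_sixteen : hexPolygonNumber 16 = 18 := by
  rw [← PolygonConcat.card_canonEnd (n := 15) (by norm_num)]; exact PolygonConcat.card_canonEnd_fifteen

/-- **`q_18(ℍ) = 65`**. [cite: GuttmannJensen2009SeriesData, Table 16.3 (n = 18: p_n = 65)] -/
theorem hexPolygonNumber_eighteen : hexPolygonNumber 18 = 65 := by
  rw [← PolygonConcat.card_canonEnd (n := 17) (by norm_num)]; exact PolygonConcat.card_canonEnd_seventeen

/-- **Madras–Slade's (3.2.3) fails on the honeycomb lattice**: `q_12(ℍ) = 2 < 3 = q_10(ℍ)`.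
[cite: MadrasSlade1993, Theorem 3.2.3, eq. (3.2.3) p. 64 (ℤ^d; here refuted on ℍ)] [cite: GuttmannJensen2009SeriesData, Table 16.3] -/
theorem hexPolygonNumber_twelve_lt_ten : hexPolygonNumber 12 < hexPolygonNumber 10 := by
  rw [hexPolygonNumber_twelve, hexPolygonNumber_ten]; norm_num

/-- **The printed step-`2` monotonicity has no honeycomb analogue from `N = 6` on**: it fails at `N = 10` (and at `N = 6`).
[cite: MadrasSlade1993, Theorem 3.2.3, eq. (3.2.3) p. 64 (ℤ^d; here refuted on ℍ)] -/
theorem not_hexPolygonNumber_le_add_two : ¬ ∀ N : ℕ, 6 ≤ N → Even N → hexPolygonNumber N ≤ hexPolygonNumber (N + 2) := by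
  intro h
  have := h 10 (by norm_num) (by decide)
  rw [hexPolygonNumber_ten, hexPolygonNumber_twelve] at this
  omega

/-- `q_6(ℍ) > q_8(ℍ)`: the step `2` also fails at `N = 6`. [cite: GuttmannJensen2009SeriesData, Table 16.3] -/
theorem hexPolygonNumber_eight_lt_six : hexPolygonNumber 8 < hexPolygonNumber 6 := by
  rw [hexPolygonNumber_eight, hexPolygonNumber_six]; norm_num

/-- `q_12(ℍ) ≤ q_14(ℍ)`: the first instance of the conjectured step-`2` monotonicity from `N = 12` on. [cite: GuttmannJensen2009SeriesData, Table 16.3] -/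
theorem hexPolygonNumber_le_add_two_twelve : hexPolygonNumber 12 ≤ hexPolygonNumber 14 := by
  rw [hexPolygonNumber_twelve, hexPolygonNumber_fourteen]; norm_num

/-- `q_14(ℍ) ≤ q_16(ℍ)`. [cite: GuttmannJensen2009SeriesData, Table 16.3] -/
theorem hexPolygonNumber_le_add_two_fourteen : hexPolygonNumber 14 ≤ hexPolygonNumber 16 := by
  rw [hexPolygonNumber_fourteen, hexPolygonNumber_sixteen]; norm_num

/-- `q_16(ℍ) ≤ q_18(ℍ)`. [cite: GuttmannJensen2009SeriesData, Table 16.3] -/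
theorem hexPolygonNumber_le_add_two_sixteen : hexPolygonNumber 16 ≤ hexPolygonNumber 18 := by
  rw [hexPolygonNumber_sixteen, hexPolygonNumber_eighteen]; norm_num

end HexBW

end Literature.Probability.RandomPlanarGeometry.SAW
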